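import Mathlib
import Summits.Ventures.PercRepro2.Defs
import Summits.Ventures.PercRepro2.Harris
import Summits.Ventures.PercRepro2.Graph
import Summits.Ventures.PercRepro2.Events
import Summits.Ventures.PercRepro2.Induced
import Summits.Ventures.PercRepro2.BHK
import Summits.Ventures.PercRepro2.BHKEvents
import Summits.Ventures.PercRepro2.BHKAvoid
import Summits.Ventures.PercRepro2.ExploreA3

/-!
# The sign lemmas of the first root-leaf-at-`u` coefficient — (I3) is a theorem
(blind cell PercRepro2, p4 g3; proofs/P4-G4U-T1.md, S3-CLASSES.md §S3.10 (G4-u) v27)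

Five vertices `o, a₂, c, b, u` of a graph (`c` plays `a₃`; `u` is the unmarked vertex at which a
root `a₁` is pendant in the class (G4-u) — the root itself is absent from these statements).
Write `K = C(a₂)`, `hb = P(b ∈ K)`, `d0 = P(c ∉ K)`, `e0 = P(o ∈ K, c ∉ K)`,
`W = {u ∈ C(c), c ↮ a₂}` (= `{c ∈ C(u), a₂ ∉ C(u)}`).

* **`I3_nonneg`** (the statement that was open in S3 v21–v26 as (I3)):
  `hb·e0·P(W) − e0·P(W, b∈K) − hb·d0·P(W, o∈K) + d0·P(W, o∈K, b∈K) ≥ 0`.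
  Proof: explore `M = C(c)` avoiding `a₂` (`prob_clusterIn_inter_avoid_eq_expect`); given `M` the
  cluster of `a₂` lives in `G ∖ M` with the residual functionals `go, gb, gob = delClusterProb`;
  the centring `e0 = E[go(M) 1_{c↮a₂}]`; Harris in `G ∖ M` (`go·gb ≤ gob`, pointwise) and ONE
  functional BHK06 Thm 1.3 (`bhk_induced`, `s = c`, `X = Y = {a₂}`, `F₁ = 1 − go`,
  `F₂ = 1_{u∈·}·(hb − gb)`, both nonnegative and monotone).
* **`B_nonneg`** (the (B) term): `P(Y, b∈K) ≤ hb·P(Y)` for `Y = {o ∈ C(u), c ∉ C(u), u ↮ a₂}`: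
  explore `C(u)` avoiding `a₂`; `gb(C(u)) ≤ hb` pointwise.
* **`I2_nonneg`** (the (C) term, the predecessor's (I2)):
  `e0·P(c,u ∉ K, b ∈ C(u)) ≥ d0·P(c,u ∉ K, o ∈ K, b ∈ C(u))`: explore `K` avoiding `{c, u}`,
  `bhk_induced` with `F₁ = 1_{o∈·}`, `F₂ = 1 − rb`, `rb = delClusterProb u {b ∈ ·}`.
All statements are probabilities of explicit events; `T1 = 2·[d0·(A) + d0·(B) + d0·(C) + d0·(D)]`
(S3 v27 (1)) is the pattern-level identity that assembles them (not in this file).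
-/

namespace Summit.Ventures.PercRepro2

namespace RootLeafU

variable {V : Type*} {E : Type*} [Fintype E] [DecidableEq E] [Fintype V] [DecidableEq V]
  {R : Type*} [Field R] [LinearOrder R] [IsStrictOrderedRing R]

section Helpers

variable (p : E → R) (ends : E → Sym2 V)

omit [Fintype E] [DecidableEq E] [Fintype V] [DecidableEq V] in
/-- `{s ↮ {t}}` is the complement of the connection event. -/
lemma avoidAll_singleton_eq (s t : V) : avoidAll ends s {t} = (connEvent ends s t)ᶜ := by
  ext ω
  simp only [avoidAll, Set.mem_setOf_eq, Finset.mem_singleton, forall_eq, Set.mem_compl_iff,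
    mem_connEvent]

omit [Fintype E] [DecidableEq E] [Fintype V] [DecidableEq V] in
/-- `{C(s) ∋ v, C(s) ∋ w}` is the intersection of the two connection events. -/
lemma clusterInEvent_mem_inter_eq (s v w : V) :
    clusterInEvent ends s ({W | v ∈ W} ∩ {W | w ∈ W}) = connEvent ends s v ∩ connEvent ends s w := by
  ext ω
  simp only [mem_clusterInEvent, Set.mem_inter_iff, Set.mem_setOf_eq, cluster, mem_connEvent]

omit [Fintype E] [DecidableEq E] [Fintype V] [DecidableEq V] in
/-- `{C(s) ∈ univ}` is everything. -/
lemma clusterInEvent_univ (s : V) : clusterInEvent ends s Set.univ = Set.univ := by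
  ext ω
  simp only [mem_clusterInEvent, Set.mem_univ]

omit [Fintype E] [DecidableEq E] [Fintype V] [DecidableEq V] in
/-- Closing edges gives a smaller configuration. -/
lemma delConfig_le (W : Set V) (ω : Config E) : delConfig ends W ω ≤ ω := by
  intro e
  by_cases he : e ∈ touches ends W
  · rw [delConfig_apply_of_mem he]
    exact Bool.false_le _
  · rw [delConfig_apply_of_notMem he]

omit [Fintype V] [DecidableEq V] [LinearOrder R] [IsStrictOrderedRing R] in
/-- The residual functional of the family `univ` is `1`. -/
lemma delClusterProb_univ (t : V) (W : Set V) :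
    delClusterProb p ends t Set.univ W = 1 := by
  unfold delClusterProb
  have : {ω : Config E | cluster ends (delConfig ends W ω) t ∈ Set.univ} = Set.univ := by
    ext ω; simp
  rw [this]
  exact prob_univ p

omit [Fintype V] [DecidableEq V] in
/-- The residual connection probability is at most the global one: `g_v(W) ≤ P(t ↔ v)`. -/
lemma delClusterProb_mem_le (hp : IsProbVec p) (t v : V) (W : Set V) :
    delClusterProb p ends t {S | v ∈ S} W ≤ prob p (connEvent ends t v) := by
  unfold delClusterProb
  refine prob_mono hp fun ω hω => ?_
  simp only [Set.mem_setOf_eq, mem_cluster] at hω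
  exact conn_mono (delConfig_le ends W ω) hω

omit [Fintype E] [DecidableEq E] [Fintype V] [DecidableEq V] in
/-- `{C(s) ∋ v, C(s) ∌ w}` is `{s ↔ v} ∩ {s ↮ w}`. -/
lemma clusterInEvent_mem_notMem_eq (s v w : V) :
    clusterInEvent ends s {W | v ∈ W ∧ w ∉ W} = connEvent ends s v ∩ (connEvent ends s w)ᶜ := by
  ext ω
  simp only [mem_clusterInEvent, Set.mem_setOf_eq, cluster, Set.mem_inter_iff, Set.mem_compl_iff,
    mem_connEvent]

end Helpers

section Signs

variable (p : E → R) (ends : E → Sym2 V) (o a₂ c b u : V)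

/-- **(I3) is a theorem** — the first-coefficient sign of (G4-u) that was open in S3 v21–v26:
`hb·e0·P(W) − e0·P(W, b∈K) − hb·d0·P(W, o∈K) + d0·P(W, o∈K, b∈K) ≥ 0` with `K = C(a₂)`,
`W = {u ∈ C(c), c ↮ a₂}`, in the cluster-event form produced by the exploration of `C(c)`. -/
theorem I3_nonneg_cl (hp : IsProbVec p) :
    0 ≤ prob p (connEvent ends a₂ b) *
          prob p (clusterInEvent ends a₂ {W | o ∈ W} ∩ avoidAll ends c {a₂}) *
          prob p (clusterInEvent ends c {W | u ∈ W} ∩ avoidAll ends c {a₂})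
        - prob p (clusterInEvent ends a₂ {W | o ∈ W} ∩ avoidAll ends c {a₂}) *
          prob p (clusterInEvent ends c {W | u ∈ W} ∩ clusterInEvent ends a₂ {W | b ∈ W} ∩
            avoidAll ends c {a₂})
        - prob p (connEvent ends a₂ b) * prob p (avoidAll ends c {a₂}) *
          prob p (clusterInEvent ends c {W | u ∈ W} ∩ clusterInEvent ends a₂ {W | o ∈ W} ∩
            avoidAll ends c {a₂})
        + prob p (avoidAll ends c {a₂}) *
          prob p (clusterInEvent ends c {W | u ∈ W} ∩
            clusterInEvent ends a₂ ({W | o ∈ W} ∩ {W | b ∈ W}) ∩ avoidAll ends c {a₂}) := by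
  classical
  set N := avoidAll ends c {a₂} with hN
  have ha2 : a₂ ∈ ({a₂} : Finset V) := by simp
  set go := delClusterProb p ends a₂ {W | o ∈ W} with hgo
  set gb := delClusterProb p ends a₂ {W | b ∈ W} with hgb
  set gob := delClusterProb p ends a₂ ({W | o ∈ W} ∩ {W | b ∈ W}) with hgob
  set hb := prob p (connEvent ends a₂ b) with hhb
  set χ : Set V → R := fun K => ({W : Set V | u ∈ W}).indicator 1 K with hχ
  -- tower identities (exploring `C(c)` under `c ↮ a₂`)
  have tO := prob_clusterIn_inter_avoid_eq_expect p ends c a₂ ha2 Set.univ {W | o ∈ W}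
  have tu := prob_clusterIn_inter_avoid_eq_expect p ends c a₂ ha2 {W | u ∈ W} Set.univ
  have tuO := prob_clusterIn_inter_avoid_eq_expect p ends c a₂ ha2 {W | u ∈ W} {W | o ∈ W}
  have tuB := prob_clusterIn_inter_avoid_eq_expect p ends c a₂ ha2 {W | u ∈ W} {W | b ∈ W}
  have tuOB := prob_clusterIn_inter_avoid_eq_expect p ends c a₂ ha2 {W | u ∈ W}
    ({W | o ∈ W} ∩ {W | b ∈ W})
  have hg1 : ∀ K, delClusterProb p ends a₂ Set.univ K = 1 := delClusterProb_univ p ends a₂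
  simp only [clusterInEvent_univ, Set.univ_inter, Set.inter_univ, Set.indicator_univ,
    Pi.one_apply, one_mul, hg1, mul_one] at tO tu tuO tuB tuOB
  -- pointwise Harris in the residual graph `G ∖ K`: `go · gb ≤ gob`
  have hpt : ∀ K, go K * gb K ≤ gob K := by
    intro K
    simp only [hgo, hgb, hgob, delClusterProb]
    have h := prob_mul_prob_le_prob_inter hp
      (ExploreA3.isUpperSet_delCluster ends a₂ K (ExploreA3.isUpperSet_mem o))
      (ExploreA3.isUpperSet_delCluster ends a₂ K (ExploreA3.isUpperSet_mem b))
    have e : {ω : Config E | cluster ends (delConfig ends K ω) a₂ ∈ {W | o ∈ W}} ∩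
        {ω | cluster ends (delConfig ends K ω) a₂ ∈ {W | b ∈ W}} =
        {ω | cluster ends (delConfig ends K ω) a₂ ∈ {W | o ∈ W} ∩ {W | b ∈ W}} := by
      ext ω
      simp only [Set.mem_setOf_eq, Set.mem_inter_iff]
    rw [e] at h
    exact h
  -- monotonicity and bounds
  have hgo_anti : Antitone go := delClusterProb_anti p hp ends a₂ (ExploreA3.isUpperSet_mem o)
  have hgb_anti : Antitone gb := delClusterProb_anti p hp ends a₂ (ExploreA3.isUpperSet_mem b)
  have hgo1 : ∀ K, go K ≤ 1 := delClusterProb_le_one p hp ends a₂ _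
  have hgb_le : ∀ K, gb K ≤ hb := delClusterProb_mem_le p ends hp a₂ b
  have hχ_mono : Monotone χ := by
    intro K K' h
    simp only [hχ]
    by_cases hu : u ∈ K
    · have hu' : u ∈ K' := h hu
      simp [Set.indicator, hu, hu']
    · simp [Set.indicator, hu]
      split_ifs <;> norm_num
  have hχ0 : ∀ K, 0 ≤ χ K := fun K => Set.indicator_apply_nonneg fun _ => zero_le_one
  have hF₁ : Monotone (fun K => 1 - go K) := fun K K' h => by simp only; linarith [hgo_anti h]
  have hF₁0 : ∀ K, 0 ≤ 1 - go K := fun K => by linarith [hgo1 K]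
  have hF₂ : Monotone (fun K => χ K * (hb - gb K)) := by
    intro K K' h
    simp only
    have h1 := hχ_mono h
    have h2 : hb - gb K ≤ hb - gb K' := by linarith [hgb_anti h]
    exact mul_le_mul h1 h2 (by linarith [hgb_le K]) (hχ0 K')
  have hF₂0 : ∀ K, 0 ≤ χ K * (hb - gb K) := fun K => mul_nonneg (hχ0 K) (by linarith [hgb_le K])
  -- the functional BHK on the cluster of `c` avoiding `a₂`
  have key := bhk_induced p hp ends c hF₁ hF₂ hF₁0 hF₂0 Finset.univ {a₂} {a₂}
    (Finset.subset_univ _) (Finset.subset_univ _)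
  simp only [Finset.inter_self, Finset.union_self, REvent_univ] at key
  have e : ∀ F : Set V → R, clusterObs ends Finset.univ c F * (avoidAll ends c {a₂}).indicator 1 =
      fun ω => F (cluster ends ω c) * (avoidAll ends c {a₂}).indicator 1 ω := by
    intro F
    funext ω
    simp only [Pi.mul_apply, clusterObs_apply, clusterIn_univ]
  rw [e, e, e] at key
  simp only [Pi.mul_apply] at key
  have eN : prob p N = expect p fun ω => N.indicator 1 ω := prob_eq_expect_indicator p _
  -- the expectations in terms of masses
  have e1 : expect p (fun ω => (1 - go (cluster ends ω c)) * N.indicator 1 ω) =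
      prob p N - prob p (clusterInEvent ends a₂ {W | o ∈ W} ∩ N) := by
    rw [tO, eN, ← expect_sub]
    congr 1
    funext ω
    simp only [Pi.sub_apply]
    ring
  have e2 : expect p (fun ω => χ (cluster ends ω c) * (hb - gb (cluster ends ω c)) *
      N.indicator 1 ω) =
      hb * prob p (clusterInEvent ends c {W | u ∈ W} ∩ N) -
        prob p (clusterInEvent ends c {W | u ∈ W} ∩ clusterInEvent ends a₂ {W | b ∈ W} ∩ N) := by
    rw [tu, tuB, ← expect_const_mul, ← expect_sub]
    congr 1
    funext ω
    simp only [Pi.sub_apply, hχ]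
    ring
  have e12 : expect p (fun ω => (1 - go (cluster ends ω c)) *
      (χ (cluster ends ω c) * (hb - gb (cluster ends ω c))) * N.indicator 1 ω) =
      hb * prob p (clusterInEvent ends c {W | u ∈ W} ∩ N) -
        prob p (clusterInEvent ends c {W | u ∈ W} ∩ clusterInEvent ends a₂ {W | b ∈ W} ∩ N) -
        hb * prob p (clusterInEvent ends c {W | u ∈ W} ∩ clusterInEvent ends a₂ {W | o ∈ W} ∩ N) +
        expect p (fun ω => χ (cluster ends ω c) * go (cluster ends ω c) *
          gb (cluster ends ω c) * N.indicator 1 ω) := by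
    rw [tu, tuB, tuO, ← expect_const_mul, ← expect_const_mul, ← expect_sub, ← expect_sub,
      ← expect_add]
    congr 1
    funext ω
    simp only [Pi.sub_apply, Pi.add_apply, hχ]
    ring
  rw [e1, e2, e12] at key
  -- `E[χ go gb 1_N] ≤ E[χ gob 1_N] = P(u ∈ C(c), o ∈ K, b ∈ K, c ↮ a₂)`
  have hE : expect p (fun ω => χ (cluster ends ω c) * go (cluster ends ω c) *
      gb (cluster ends ω c) * N.indicator 1 ω) ≤
      prob p (clusterInEvent ends c {W | u ∈ W} ∩
        clusterInEvent ends a₂ ({W | o ∈ W} ∩ {W | b ∈ W}) ∩ N) := by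
    rw [tuOB]
    refine expect_mono hp fun ω => ?_
    have h1 := hpt (cluster ends ω c)
    have h2 := hχ0 (cluster ends ω c)
    have h3 : (0 : R) ≤ N.indicator 1 ω := Set.indicator_apply_nonneg fun _ => zero_le_one
    simp only [hχ] at h2 ⊢
    calc ({W : Set V | u ∈ W}).indicator 1 (cluster ends ω c) * go (cluster ends ω c) *
          gb (cluster ends ω c) * N.indicator 1 ω
        = ({W : Set V | u ∈ W}).indicator 1 (cluster ends ω c) *
            (go (cluster ends ω c) * gb (cluster ends ω c)) * N.indicator 1 ω := by ring
      _ ≤ ({W : Set V | u ∈ W}).indicator 1 (cluster ends ω c) * gob (cluster ends ω c) *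
            N.indicator 1 ω := by
          exact mul_le_mul_of_nonneg_right (mul_le_mul_of_nonneg_left h1 h2) h3
  have hn0 : 0 ≤ prob p N := prob_nonneg hp _
  nlinarith [key, hE, hn0]

/-- **(I3) in connection events**: with `hb = P(a₂ ↔ b)`, `d0 = P(c ↮ a₂)`, `e0 = P(a₂ ↔ o, c ↮ a₂)`
and `W = {c ↔ u, c ↮ a₂}`,
`hb·e0·P(W) − e0·P(W, a₂ ↔ b) − hb·d0·P(W, a₂ ↔ o) + d0·P(W, a₂ ↔ o, a₂ ↔ b) ≥ 0`. -/
theorem I3_nonneg (hp : IsProbVec p) :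
    0 ≤ prob p (connEvent ends a₂ b) *
          prob p (connEvent ends a₂ o ∩ (connEvent ends c a₂)ᶜ) *
          prob p (connEvent ends c u ∩ (connEvent ends c a₂)ᶜ)
        - prob p (connEvent ends a₂ o ∩ (connEvent ends c a₂)ᶜ) *
          prob p (connEvent ends c u ∩ connEvent ends a₂ b ∩ (connEvent ends c a₂)ᶜ)
        - prob p (connEvent ends a₂ b) * prob p (connEvent ends c a₂)ᶜ *
          prob p (connEvent ends c u ∩ connEvent ends a₂ o ∩ (connEvent ends c a₂)ᶜ)
        + prob p (connEvent ends c a₂)ᶜ *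
          prob p (connEvent ends c u ∩ (connEvent ends a₂ o ∩ connEvent ends a₂ b) ∩
            (connEvent ends c a₂)ᶜ) := by
  have h := I3_nonneg_cl p ends o a₂ c b u hp
  simpa only [ExploreA3.clusterInEvent_mem_eq, clusterInEvent_mem_inter_eq, avoidAll_singleton_eq] using h

end Signs

end RootLeafU

end Summit.Ventures.PercRepro2
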